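import Literature.MathematicalPhysics.QuantumFieldTheory.ConformalBootstrap3D.PointKernelK34L505Data
import Literature.MathematicalPhysics.QuantumFieldTheory.ConformalBootstrap3D.PointKernelK34L505Segs
import Literature.MathematicalPhysics.QuantumFieldTheory.ConformalBootstrap3D.PointKernelParts

/-!
# K34L505 certificate, kernel part file P19: one-cell head segments 93, 94 in level ranges

The head cells whose kernel evaluation exceeds one `decide` are one-cell segments of `hsegsK34L505`; each is
checked by `PCert.hPartSideOK` (side conditions) and `PCert.hPartOK` per level range `[n_lo, n_lo + count)`
against an integer claim, the claims summing to `≥ 0` (`PointKernel.partsOK`); soundness is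
`PCert.hParts_sound` (`PointKernelParts`).  The part files are mutually independent (each imports only
the data file); the ranges of one cell may span several of them, and the per-cell conclusions
`hparts_i` / `hcell_i` of those cells are assembled in `PointKernelK34L505.lean`.
Estimated kernel time 246 s.
-/

set_option maxRecDepth 100000
set_option maxHeartbeats 0

namespace Literature.MathematicalPhysics.QuantumFieldTheory.ConformalBootstrap3D.PointKernelK34L505

open Literature.MathematicalPhysics.QuantumFieldTheory.ConformalBootstrap3D.PointKernel

/-- levels `[71, 73)` of segment 93: partial lower sum `≥` claim. [folklore] -/
theorem part_93_9 : certK34L505.hPartOK (PCert.segAt hsegsK34L505 93) JHK34L505 71 2 (31733882436304379647008490620910449) = true := by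
  decide +kernel

/-- one-cell segment 94 (row 6, cell `[57345/8192, 28673/4096]`, chord, `n_F = 72`,
10 level ranges): side conditions. [folklore] -/
theorem pside_94 : certK34L505.hPartSideOK (PCert.segAt hsegsK34L505 94) JHK34L505 = true := by
  decide +kernel

/-- its level ranges `(n_lo, count, claim)`. [folklore] -/
def partsK34L505_94 : List (ℕ × ℕ × ℤ) := [(0, 25, -28619984504733602900627338590523900298), (25, 11, 18425301118856138711488222254620954944), (36, 8, 6006788712340333583224992471146768668), (44, 6, 2149172590713143754271237832388512667), (50, 5, 971480106341945505268875472598250865), (55, 5, 551838511147136433613435726978446431), (60, 4, 257444662879521411326557065277836480), (64, 4, 158501656830264993353882899960640286), (68, 3, 71730894529507305423175606550073699), (71, 2, 27726251095611202656959261002416260)]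

/-- the ranges tile `[0, n_F]` and the claims sum to `≥ 0`. [folklore] -/
theorem pcov_94 : PointKernel.partsOK 72 partsK34L505_94 = true := by
  decide +kernel

/-- levels `[0, 25)` of segment 94: partial lower sum `≥` claim. [folklore] -/
theorem part_94_0 : certK34L505.hPartOK (PCert.segAt hsegsK34L505 94) JHK34L505 0 25 (-28619984504733602900627338590523900298) = true := by
  decide +kernel

/-- levels `[25, 36)` of segment 94: partial lower sum `≥` claim. [folklore] -/
theorem part_94_1 : certK34L505.hPartOK (PCert.segAt hsegsK34L505 94) JHK34L505 25 11 (18425301118856138711488222254620954944) = true := by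
  decide +kernel

/-- levels `[36, 44)` of segment 94: partial lower sum `≥` claim. [folklore] -/
theorem part_94_2 : certK34L505.hPartOK (PCert.segAt hsegsK34L505 94) JHK34L505 36 8 (6006788712340333583224992471146768668) = true := by
  decide +kernel

end Literature.MathematicalPhysics.QuantumFieldTheory.ConformalBootstrap3D.PointKernelK34L505
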